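import Mathlib
import HarnessLib
import Summits.HubbardSuperconductivity.HubbardSuperconductivity.Theorems.ComplexGFFStiffnessHolomorphicStepFamily
import Literature.MathematicalPhysics.StatisticalMechanics.RGStepABKMQ
import Literature.MathematicalPhysics.StatisticalMechanics.FlowStepIntegrability

/-!
# Crux `HypACumulant`, children `H1bcStatement` / `F4StatementOfCores` — S6c, the MODEL-SPECIFIC DISCHARGE:
# `σ ↦ S_k(H + σU, mulExt(a + σ b))` is holomorphic for the [ABKM19] torus step data

Route `route-HubbardSuperconductivity-ComplexGFFStiffness`, crux stmt-HubbardSuperconductivity-19154; census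
entry S6c of the holomorphic route (memo CUMULANT-PLAN §9).  For the step data
`D = abkmStepData L R k 𝒞s` of a step-kernel family with `StepKernelBounds` (Theorem 7.1 weights,
`q = 0` norms) the three hypotheses left open by `differentiableOn_nextKStep_family` are DISCHARGED:

* the step-data facts of `nextH_eq` (positive kernel, reference block with room) — as in
  `NextHamiltonianBoundsQ`;
* integrability / `C²` of the block activities `a(B₀, ·)`, `b(B₀, ·)` — `StepKernelBoundsABKM`;
* measurability and a **`σ`-UNIFORM `μ_{k+1}`-INTEGRABLE BOUND of the intermediate functional** `Φ_σ(X, φ, ·)`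
  on the disc: by the expansion (6.32) (`midK_eq_sum`) and Lemma 8.3/9.3 (`tayNormLE_bprod_expNegH_mul_abkm`,
  degree zero) every term is bounded by a constant times the weight `w_k^{W ∪ Z'}(φ + ξ)`, uniformly for
  `‖H + σU‖_{k,0} ≤ ⅛` and `‖a + σ b‖_k ≤ C`, and the weights are `μ_{k+1}`-integrable
  (`StepKernelBounds.integrable_weight`, Lemma 8.4).

Result: **`differentiableOn_nextKStep_abkm_lineAct`** — `σ ↦ nextKStep (abkmStepData L R k 𝒞s) (H + σU)
(mulExt (a + σ b)) U' φ` is holomorphic on every disc on which `‖H + σU‖_{k,0} ≤ ⅛`.  All proved, no `sorry`.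
Honest scope: toolchain for the state-regularity slots of a rung route (stiffness of a complex Gaussian gradient
field via the [ABKM19] RG); nothing about superconductivity in the Hubbard model.

## References
* S. Adams, S. Buchholz, R. Kotecký, S. Müller, arXiv:1910.13564, Definition 6.5 (6.32)–(6.35), Lemma 8.3,
  Lemma 8.4, Lemma 9.3, Theorem 6.8 [AdamsBuchholzKoteckyMuller2019].
-/

noncomputable section

-- `Summit.<Summit>.<Problem>`: single-conjunct summit, the duplicate component is mandated (D-0017).
set_option linter.dupNamespace false

namespace Summit.HubbardSuperconductivity.HubbardSuperconductivity.Theorems.ComplexGFF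

open MeasureTheory Metric Set
open scoped BigOperators
open Literature.MathematicalPhysics.StatisticalMechanics.GradientRG
open Literature.MathematicalPhysics.StatisticalMechanics.TorusPolymer (bprod blocks pcirc polys reblock IsPolymer mem_polys
  blockOf isConn_blockOf isPolymer_blockOf mem_blockOf_self polys_mono blocks_mono)
open Literature.Barriers.CriticalPhenomena.LongRangePhi4.Polymer (IsConn components)
open Literature.MathematicalPhysics.StatisticalMechanics

variable {d M : ℕ} [NeZero M]

set_option maxHeartbeats 800000 in
/-- **S6c (model-specific discharge): `K_{k+1}` of the [ABKM19] torus step is holomorphic along every complex line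
`(H + σU, mulExt(a + σ b))` in the state**, pointwise in the polymer `U'` and the field `φ`, on any disc where
`‖H + σU‖_{k,0} ≤ ⅛`; `a, b` admissible activities (`C^{r₀}`, local, finite weak norm), kernel by predicate
(`StepKernelBounds` at scale `k + 1 ≤ N`). -/
theorem differentiableOn_nextKStep_abkm_lineAct {L N Mord R n p r₀ : ℕ} {θbar lam μ δ₁ δ₀ A𝒫 A𝒫' C₂ h A : ℝ}
    {𝒞 : ℕ → (Fin d → ZMod M) → ℝ} (hd : 3 ≤ d) (hLodd : Odd L) (hL : 2 ^ (d + 3) + 16 * R ≤ L)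
    (hM : M = L ^ N) {k : ℕ} (hkN : k + 1 ≤ N) (hp : d / 2 + 2 ≤ p) (hpM : p + d ≤ Mord) (hMR : Mord ≤ R)
    (hr₀ : 2 ≤ r₀)
    (hB : AbkmWeightBounds L N Mord R n θbar lam μ δ₁ δ₀ A𝒫 𝒞
      (abkmWeightData L N Mord R θbar (schedDelta δ₀ δ₁ N) 𝒞))
    (hδ₀ : 0 < δ₀) (hδ₁ : 0 < δ₁) (hh : 0 < h) (hh0 : hZeroSq d R δ₀ δ₁ ≤ h ^ 2) (hA1 : 1 ≤ A)
    (𝒞s : ℕ → (Fin d → ZMod M) → ℝ)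
    (hS : StepKernelBounds (abkmWeightData L N Mord R θbar (schedDelta δ₀ δ₁ N) 𝒞) L k A𝒫' C₂ (𝒞s (k + 1)))
    (H U : RelevantHamiltonian ℂ d)
    {a b : Finset (Fin d → ZMod M) → ((Fin d → ZMod M) → ℝ) → ℂ} {Ca Cb : ℝ} (hCa : 0 ≤ Ca) (hCb : 0 ≤ Cb)
    (ha : WeakNormLE (abkmNormParams L N Mord R p r₀ h θbar A (schedDelta δ₀ δ₁ N) 𝒞) k a Ca)
    (hb : WeakNormLE (abkmNormParams L N Mord R p r₀ h θbar A (schedDelta δ₀ δ₁ N) 𝒞) k b Cb)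
    (had : ∀ Y, ContDiff ℝ r₀ (a Y)) (hbd : ∀ Y, ContDiff ℝ r₀ (b Y))
    (haloc : ∀ Y, IsPolymer (L ^ k) Y → IsConn Y →
      IsGaugeLocal ((abkmNormParams L N Mord R p r₀ h θbar A (schedDelta δ₀ δ₁ N) 𝒞).gauge k Y) (a Y))
    (hbloc : ∀ Y, IsPolymer (L ^ k) Y → IsConn Y →
      IsGaugeLocal ((abkmNormParams L N Mord R p r₀ h θbar A (schedDelta δ₀ δ₁ N) 𝒞).gauge k Y) (b Y))
    {Rb : ℝ} (hHR : ∀ σ ∈ ball (0 : ℂ) Rb, hamNorm (fieldWt h (L : ℝ) d k) ((L : ℝ) ^ k) (L ^ (d * k)) (H + σ • U) ≤ 1 / 8)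
    (U' : Finset (Fin d → ZMod M)) (φ : (Fin d → ZMod M) → ℝ) :
    DifferentiableOn ℂ (fun σ : ℂ => nextKStep (abkmStepData L R k 𝒞s) (H + σ • U) (mulExt ((a + σ • b))) U' φ)
      (ball (0 : ℂ) Rb) := by
  set P := abkmNormParams L N Mord R p r₀ h θbar A (schedDelta δ₀ δ₁ N) 𝒞 with hP
  set Wt := abkmWeightData L N Mord R θbar (schedDelta δ₀ δ₁ N) 𝒞 with hWt
  set D := abkmStepData L R k 𝒞s with hD
  have hDs : D.s = L ^ k := rfl
  have hD𝒞 : D.𝒞 = 𝒞s (k + 1) := rfl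
  have hDB₀ : D.B₀ = blockOf (L ^ k) 0 := rfl
  have hDc₀ : D.c₀ = TorusPolymer.boxCorner (L ^ k) (starRad R L d k) 0 := rfl
  have hA : 0 < A := by linarith
  have hPA : 0 < P.A := hA
  have hL0 : (0 : ℝ) < L := by exact_mod_cast hLodd.pos
  have hk1 : 1 ≤ L ^ k := Nat.one_le_pow _ _ hLodd.pos
  have hMo : Odd M := by rw [hM]; exact hLodd.pow
  have hsodd : Odd (L ^ k) := hLodd.pow
  obtain ⟨t, ht⟩ : ∃ t, N = k + t := ⟨N - k, by omega⟩
  have hMt0 : M = L ^ k * L ^ t := by rw [← pow_add, ← ht]; exact hM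
  -- the step-data facts of `nextH_eq`
  have hC𝒞 : (Matrix.circulant D.𝒞).PosSemidef := hS.posSemidef
  have hBne : D.B₀.card ≠ 0 := by
    rw [hDB₀]; exact (Finset.card_pos.2 ⟨0, mem_blockOf_self _ 0⟩).ne'
  obtain ⟨hwrap0, hroom0⟩ := abkm_box_lt (d := d) hL (show p ≤ R by omega) hkN
  have hwrap : 4 * ((L ^ k - 1) / 2 + starRad R L d k) < M := by rw [hM]; exact hwrap0
  have hroomB : ∀ x ∈ D.B₀, HasRoom D.c₀ x (d / 2 + 1) := by
    intro x hx
    have hxS : x ∈ TorusPolymer.thicken (starRad R L d k) (blockOf (L ^ k) 0) := by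
      rw [← hDB₀]; exact TorusPolymer.subset_thicken _ _ hx
    have hin := (TorusPolymer.mem_thicken_blockOf_iff_inBox hMt0 hLodd.pow hLodd.pow hwrap 0 x).1 hxS
    rw [hDc₀]
    refine TorusPolymer.hasRoom_of_inBox hin ?_
    have h2 : ((2 * ((L ^ k - 1) / 2 + starRad R L d k) : ℕ) + ((d / 2 + 1 : ℕ) : ℤ)) * 2 < (M : ℤ) := by
      have : (2 * ((L ^ k - 1) / 2 + starRad R L d k) + (d / 2 + 1)) * 2 < M := by
        rw [hM]; have := hroom0; omega
      exact_mod_cast this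
    exact_mod_cast h2
  -- the reference block is a connected `k`-polymer
  have hB₀conn : IsConn D.B₀ := by rw [hDB₀]; exact isConn_blockOf hMo hsodd 0
  have hB₀poly : IsPolymer (L ^ k) D.B₀ := by rw [hDB₀]; exact isPolymer_blockOf _ 0
  -- block activities: integrable and `C²` after fluctuation
  have hai : ∀ ψ, Integrable (fun ξ => a D.B₀ (ψ + ξ)) (stepMeasure D.𝒞) := fun ψ =>
    integrable_comp_add_of_weakNormLE_of_stepKernelBounds hB hS hA hCa ha had haloc hB₀poly hB₀conn ψ
  have hbi : ∀ ψ, Integrable (fun ξ => b D.B₀ (ψ + ξ)) (stepMeasure D.𝒞) := fun ψ =>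
    integrable_comp_add_of_weakNormLE_of_stepKernelBounds hB hS hA hCb hb hbd hbloc hB₀poly hB₀conn ψ
  have hr₀2 : ((2 : ℕ) : WithTop ℕ∞) ≤ (r₀ : WithTop ℕ∞) := by exact_mod_cast hr₀
  have had2 : ContDiff ℝ 2 (fluct D.𝒞 (a D.B₀)) :=
    (contDiff_fluct_of_weakNormLE_of_stepKernelBounds hB hS hA hCa ha had haloc hB₀poly hB₀conn).of_le hr₀2
  have hbd2 : ContDiff ℝ 2 (fluct D.𝒞 (b D.B₀)) :=
    (contDiff_fluct_of_weakNormLE_of_stepKernelBounds hB hS hA hCb hb hbd hbloc hB₀poly hB₀conn).of_le hr₀2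
  -- the uniform weak-norm constant of the line on the disc
  set C : ℝ := Ca + max Rb 0 * Cb with hCdef
  have hC0 : 0 ≤ C := by positivity
  have hKσ : ∀ σ ∈ ball (0 : ℂ) Rb, WeakNormLE P k (mulExt ((a + σ • b))) C := by
    intro σ hσ
    have hσ' : ‖σ‖ ≤ max Rb 0 := (le_of_lt (mem_ball_zero_iff.1 hσ)).trans (le_max_left _ _)
    refine weakNormLE_mulExt_iff.2 ((weakNormLE_lineAct ha hb had hbd σ).mono hPA ?_)
    nlinarith
  have hKd : ∀ σ Y, ContDiff ℝ r₀ (mulExt ((a + σ • b)) Y) := fun σ Y =>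
    contDiff_mulExt (contDiff_lineAct had hbd σ) Y
  have hKloc : ∀ σ Y, IsPolymer (L ^ k) Y → IsConn Y → IsGaugeLocal (P.gauge k Y) (mulExt ((a + σ • b)) Y) :=
    fun σ Y hY hYc => isGaugeLocal_mulExt_conn (P.gauge k)
      (fun Y' hY' hY'c => isGaugeLocal_lineAct (haloc Y' hY' hY'c) (hbloc Y' hY' hY'c) σ) hY hYc
  -- apply the structural pass for families
  refine differentiableOn_nextKStep_family D hC𝒞 hBne hroomB H U (fun σ => mulExt ((a + σ • b)))
    (fun Y ψ => differentiable_mulExt_lineAct a b Y ψ) (a := a) (b := b)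
    (fun σ => mulExt_lineAct_of_isConn a b hB₀conn σ) hai hbi had2 hbd2 U' φ ?_ ?_
  · -- measurability of `Φ_σ(X, φ, ·)`
    intro X hX σ
    exact (measurable_midK_snd hX (fun B _ => measurable_expNegH _ B)
      (fun Y _ => measurable_mulExt (fun Y' => (contDiff_lineAct had hbd σ Y').continuous.measurable) Y) φ).aestronglyMeasurable
  · -- the `σ`-uniform integrable bound of `Φ_σ(X, φ, ·)`
    intro X hX
    set Ht := nextH D H a with hHt
    set Ut := nextH D U b with hUt
    -- prefactor bounds on the closed disc
    have hMY : ∀ Y : Finset (Fin d → ZMod M), ∃ MY : ℝ, ∀ σ ∈ closedBall (0 : ℂ) Rb,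
        ‖bprod D.s (fun B => 1 - expNegH (Ht + σ • Ut) B φ) Y‖ ≤ MY := fun Y =>
      (isCompact_closedBall (0 : ℂ) Rb).exists_bound_of_continuousOn
        ((differentiable_bprod_one_sub_expNegH_line D.s Ht Ut Y φ).continuous.continuousOn)
    choose MY hMY using hMY
    -- the inner constant of Lemma 8.3 / 9.3
    set cW : Finset (Fin d → ZMod M) → Finset (Fin d → ZMod M) → ℝ := fun W Z' =>
      (∏ _B ∈ blocks (L ^ k) W, Real.exp (1 / 4)) * ∏ Y' ∈ components Z', C * P.aFactor k Y' with hcW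
    refine ⟨fun ξ => ∑ Y ∈ polys D.s X, ∑ Z ∈ polys D.s (X \ Y), ∑ W ∈ polys D.s Z,
      MY Y * (cW W ((X \ Y) \ Z) * Wt.weight k (W ∪ ((X \ Y) \ Z)) (φ + ξ)), ?_, ?_⟩
    · -- integrability: finite sums of weights
      refine integrable_finsetSum _ fun Y _ => integrable_finsetSum _ fun Z _ =>
        integrable_finsetSum _ fun W _ => ?_
      exact ((hS.integrable_weight hB.dominated (W ∪ ((X \ Y) \ Z)) φ).const_mul _).const_mul _
    · -- the bound, term by term
      intro σ hσ ξ
      have hσc : σ ∈ closedBall (0 : ℂ) Rb := ball_subset_closedBall hσ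
      have hHσ := hHR σ hσ
      rw [midK_eq_sum]
      refine (norm_sum_le _ _).trans (Finset.sum_le_sum fun Y hY => (norm_sum_le _ _).trans
        (Finset.sum_le_sum fun Z hZ => (norm_sum_le _ _).trans (Finset.sum_le_sum fun W hW => ?_)))
      have hYp : IsPolymer (L ^ k) Y := (mem_polys.1 hY).2
      have hZp : IsPolymer (L ^ k) Z := (mem_polys.1 hZ).2
      have hWp : IsPolymer (L ^ k) W := (mem_polys.1 hW).2
      set Z' := (X \ Y) \ Z with hZ'
      have hZ'p : IsPolymer (L ^ k) Z' := (hX.sdiff hYp).sdiff hZp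
      have hWZ' : Disjoint W Z' := by
        rw [hZ']
        exact Finset.disjoint_of_subset_left (mem_polys.1 hW).1 Finset.disjoint_sdiff
      -- Lemma 8.3 / 9.3 at degree zero
      have hT := tayNormLE_bprod_expNegH_mul_abkm (p := p) (r₀ := r₀) (by omega) hLodd hM (by omega) (by omega)
        (by omega) hB hδ₀ hδ₁ hh hh0 hA hWp hZ'p hWZ' hHσ hC0 (hKσ σ hσ) (factorises_mulExt hk1)
        (fun ψ => mulExt_empty ψ) (hKd σ) (hKloc σ)
      -- locality of the term for the gauge of `W ∪ Z'`
      have h𝔥 : 0 < P.𝔥 k := fieldWt_pos hh hL0 d k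
      have hR : 0 < P.R k := by show (0 : ℝ) < (L : ℝ) ^ k; positivity
      have hPp : d / 2 + 1 ≤ P.p := by show d / 2 + 1 ≤ p; omega
      have hloc : IsGaugeLocal (P.gauge k (W ∪ Z'))
          (fun ψ => bprod (L ^ k) (fun B => expNegH (H + σ • U) B ψ) W * mulExt ((a + σ • b)) Z' ψ) := by
        refine IsGaugeLocal.mul ?_ ?_
        · unfold TorusPolymer.bprod
          refine IsGaugeLocal.prod _ fun B hBW => ?_
          have hBX : B ⊆ W ∪ Z' := (hWp.subset_of_mem_blocks hBW).trans Finset.subset_union_left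
          exact (isGaugeLocal_cexp_neg_eval h𝔥.ne' hR.ne' hPp (TorusPolymer.subset_thicken _ _) (H + σ • U)).of_norm_le
            fun ζ => norm_fieldGauge_mono_set _ _ _ (TorusPolymer.thicken_mono _ hBX) ζ
        · have hpoly : ∀ Y' ∈ components Z', IsPolymer (L ^ k) Y' := fun Y' hY' =>
            (TorusPolymer.IsPolymer.of_mem_components hMo hLodd.pow hZ'p hY').1
          have hKeq : mulExt ((a + σ • b)) Z' = fun ψ => ∏ Y' ∈ components Z', (a + σ • b) Y' ψ := by
            funext ψ; exact mulExt_apply Z' ψ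
          rw [hKeq]
          refine IsGaugeLocal.prod _ fun Y' hY' => ?_
          obtain ⟨hY'p, hY'c⟩ := TorusPolymer.IsPolymer.of_mem_components hMo hLodd.pow hZ'p hY'
          have hY'X : Y' ⊆ W ∪ Z' := by
            refine subset_trans ?_ Finset.subset_union_right
            rw [Literature.Barriers.CriticalPhenomena.LongRangePhi4.Polymer.eq_biUnion_components Z']
            exact Finset.subset_biUnion_of_mem id hY'
          exact (isGaugeLocal_lineAct (haloc Y' hY'p hY'c) (hbloc Y' hY'p hY'c) σ).of_norm_le
            fun ζ => norm_fieldGauge_mono_set _ _ _ (TorusPolymer.thicken_mono _ hY'X) ζ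
      have hpt := hT.norm_apply_le hloc (φ + ξ)
      have hpt' : ‖bprod D.s (fun B => expNegH (H + σ • U) B (φ + ξ)) W * mulExt (a + σ • b) Z' (φ + ξ)‖ ≤
          cW W Z' * Wt.weight k (W ∪ Z') (φ + ξ) := hpt
      -- the prefactor
      have h1 : ‖bprod D.s (fun B => 1 - expNegH (Ht + σ • Ut) B φ) Y‖ ≤ MY Y := hMY Y σ hσc
      have h2 : ‖((-1 : ℂ) ^ (blocks D.s (Z \ W)).card)‖ = 1 := by simp
      have hMY0 : 0 ≤ MY Y := (norm_nonneg _).trans h1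
      calc ‖bprod D.s (fun B => 1 - expNegH (Ht + σ • Ut) B φ) Y * (-1 : ℂ) ^ (blocks D.s (Z \ W)).card *
              (bprod D.s (fun B => expNegH (H + σ • U) B (φ + ξ)) W * mulExt (a + σ • b) ((X \ Y) \ Z) (φ + ξ))‖
          = ‖bprod D.s (fun B => 1 - expNegH (Ht + σ • Ut) B φ) Y‖ * ‖((-1 : ℂ) ^ (blocks D.s (Z \ W)).card)‖ *
              ‖bprod D.s (fun B => expNegH (H + σ • U) B (φ + ξ)) W * mulExt (a + σ • b) Z' (φ + ξ)‖ := by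
            rw [norm_mul, norm_mul]
        _ ≤ MY Y * 1 * (cW W Z' * Wt.weight k (W ∪ Z') (φ + ξ)) :=
            mul_le_mul (mul_le_mul h1 h2.le (norm_nonneg _) hMY0) hpt' (norm_nonneg _) (mul_nonneg hMY0 zero_le_one)
        _ = MY Y * (cW W ((X \ Y) \ Z) * Wt.weight k (W ∪ ((X \ Y) \ Z)) (φ + ξ)) := by rw [mul_one]

end Summit.HubbardSuperconductivity.HubbardSuperconductivity.Theorems.ComplexGFF

end
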